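import Mathlib
import Literature.NumberTheory.Transcendental.KZRulesAssociator
import Literature.NumberTheory.Transcendental.KZProductIdeal
import Literature.NumberTheory.Transcendental.KZGaussMultiplicationChain
import Summits.KontsevichZagierPeriods.KontsevichZagierPeriods.Theorems.HyperbolicBlochOffTetraSectorKernelStubLindemannRing
import Summits.KontsevichZagierPeriods.KontsevichZagierPeriods.Theorems.HyperbolicBlochOffTetraSectorKernelLindemannRingMembers
import Summits.KontsevichZagierPeriods.KontsevichZagierPeriods.Theorems.HyperbolicBlochOffTetraSectorKernelStubZetaBoxTriangle
import Summits.KontsevichZagierPeriods.KontsevichZagierPeriods.Theorems.HyperbolicBlochOffTetraSectorKernelStubZetaBoxOddEvenAll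
import Summits.KontsevichZagierPeriods.KontsevichZagierPeriods.Theorems.HyperbolicBlochOffTetraSectorKernelStubArctanBoxPower
import Summits.KontsevichZagierPeriods.KontsevichZagierPeriods.Theorems.CompiledSubstitutionsZetaEvenBKC
import Summits.KontsevichZagierPeriods.KontsevichZagierPeriods.Theorems.MzvKernelInKZ.Negative.ZetaTwo
import Summits.KontsevichZagierPeriods.KontsevichZagierPeriods.Theorems.HyperbolicBlochOffTetraSectorKernelWeightOneEnvelope

/-!
# Lindemann's ring: the even zeta values and `Li₂(1)` — crux `OffTetraSectorKernel`, line `odd-hyperbolic-ladder` (v8, lead c6)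

Companion of `…StubLindemannRing.lean` / `…LindemannRingMembers.lean`. THE EVEN ZETA BOXES OF EVERY WEIGHT
AND KONTSEVICH–ZAGIER'S `ζ(2)`-TRIANGLE LIE IN LINDEMANN'S RING `R_π` (the subring of the formal period ring
generated by the algebraic points and the arctangent carrier `A = [(0,1), 1/(1+t²)]`):

* `lindemann_mem_arctanBox` — `⟦[(0,1)ⁿ, ∏ 1/(1+xᵢ²)]⟧ = ⟦A⟧ⁿ` (`stub_arctanBoxPower`);
* `lindemann_mem_zetaBoxSqAll` — `[(0,1)^{2k}, 1/(1−∏xᵢ²)] ~ [(0,1)^{2k}, q·∏ 1/(1+xᵢ²)]`, `q ∈ ℚ`: Euler's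
  `ζ(2k) ∈ ℚπ^{2k}` INSIDE the calculus, the landed crux `ZetaEvenBKC` of route CompiledSubstitutions
  (Beukers–Kolk–Calabi's rational substitution + Elkies' dissection);
* `lindemann_mem_zetaBoxAll` — `(4^k − 1)·[(0,1)^{2k}, 1/(1−∏xᵢ)] ≡ 4^k·[(0,1)^{2k}, 1/(1−∏xᵢ²)]`
  (`stub_zetaBoxOddEvenAll`) and integer division inside the ring: EVERY EVEN ZETA BOX is in `R_π`;
* `lindemann_mem_zetaBox`, `lindemann_mem_dilogOne` — weight two: KZ's box `[(0,1)², 1/(1−xy)]` and the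
  `Li₂(1)`-triangle `[{0<v<u<1}, 1/(u(1−v))]` (`stub_zetaBoxTriangle`); `lindemann_mem_zetaTwoWord` —
  Kontsevich's iterated-integral word `[Δ₂, ω₀ω₁]` of `ζ(2)` (the same set).

CONSEQUENCES (`stub_lindemannRing`: equal values ⇒ equal classes on `R_π`):
* `lindemann_equivalent_of_value_eq` — EQUAL VOLUME ⇒ KZ-EQUIVALENT across Lindemann's ring (points, arctangent
  carriers, discs, ellipses, even balls, even zeta boxes, `Li₂(1)`, and all their products);
* `basel_mem_relations` — BASEL INSIDE THE CALCULUS: `6·[Li₂(1)-triangle] − [D × D] ∈ relations` for the open unit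
  disc `D` (Kontsevich–Zagier §1.2; the transcendence-free chain `3·[Δ₂, ω₀₁] ≡ 2·[Q²]` is the tree's
  `MzvKernelInKZ.Negative.three_zeta_two_sub_two_G2_mem`);
* `ballFour_two_discs_mem_relations` — `2·[B₄] − [D × D] ∈ relations` (`vol B₄ = π²/2`), transcendence-free:
  `2·⟦B₄⟧ = ⟦β(½,½)⟧² = ⟦D⟧²` in `P`.

References: M. Kontsevich, D. Zagier, *Periods* (2001), §1.1–1.2, §4.1; F. Beukers, J. Kolk, E. Calabi,
Nieuw Arch. Wisk. (4) 11 (1993); F. Lindemann, Math. Ann. 20 (1882).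
-/

noncomputable section

open Set MeasureTheory
open Literature.NumberTheory.Transcendental

namespace Summit.KontsevichZagierPeriods.HyperbolicBloch.OffTetraSectorKernel

/-! ## The even zeta boxes -/

/-- **The arctangent boxes lie in Lindemann's ring**: `⟦[(0,1)ⁿ, ∏ 1/(1+xᵢ²)]⟧ = ⟦A⟧ⁿ` (`stub_arctanBoxPower`).
[cite: KontsevichZagier2001, §4.1] -/
theorem lindemann_mem_arctanBox (n : ℕ) (B : KZ.IntegralRep n)
    (hBd : B.domain = {x | ∀ i, x i ∈ Set.Ioo (0:ℝ) 1})
    (hBi : Set.EqOn B.integrand (fun x => ∏ i, 1 / (1 + x i ^ 2)) B.domain) :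
    KZ.toFormalPeriod (KZ.of B) ∈ Subring.closure
      ({p : KZ.FormalPeriodRing | ∃ (a : ℝ) (ha : IsAlgebraic ℚ a),
          p = KZ.toFormalPeriod (KZ.of (KZ.IntegralRep.unit.constMul a ha))} ∪
        {p : KZ.FormalPeriodRing | ∃ A : KZ.IntegralRep 1, A.domain = {t | t 0 ∈ Set.Ioo (0:ℝ) 1} ∧
          Set.EqOn A.integrand (fun t => 1 / (1 + t 0 ^ 2)) A.domain ∧ p = KZ.toFormalPeriod (KZ.of A)}) := by
  obtain ⟨A, hAd, hAi⟩ := lindemann_exists_arc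
  rw [stub_arctanBoxPower n A B hAd hAi hBd hBi]
  exact Subring.pow_mem _ (lindemann_mem_arc A hAd hAi) n

/-- A pinned box `[(0,1)ⁿ, 1/(1−∏xᵢ²)]` exists as soon as the zeta box `[(0,1)ⁿ, 1/(1−∏xᵢ)]` does: on the
open box `0 ≤ 1/(1−∏xᵢ²) ≤ 1/(1−∏xᵢ)`. [cite: KontsevichZagier2001, §1.1] -/
theorem lindemann_exists_zetaBoxSq {n : ℕ} (hn : n ≠ 0) (Z : KZ.IntegralRep n)
    (hZd : Z.domain = {x | ∀ i, x i ∈ Set.Ioo (0:ℝ) 1})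
    (hZi : Set.EqOn Z.integrand (fun x => 1 / (1 - ∏ i, x i)) Z.domain) :
    ∃ Z' : KZ.IntegralRep n, Z'.domain = {x | ∀ i, x i ∈ Set.Ioo (0:ℝ) 1} ∧
      Set.EqOn Z'.integrand (fun x => 1 / (1 - ∏ i, x i ^ 2)) Z'.domain := by
  have hbox : ∀ x ∈ Z.domain, (0 < ∏ i, x i) ∧ (∏ i, x i) < 1 := fun x hx => by
    rw [hZd] at hx
    exact ⟨Finset.prod_pos fun i _ => (hx i).1,
      BoxIntegral.prod_mem_Ioo hn (fun i => hx i) |>.2⟩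
  have hsq : ∀ x ∈ Z.domain, (∏ i, x i ^ 2) = (∏ i, x i) ^ 2 := fun x _ => Finset.prod_pow _ 2 _
  have hden : ∀ x ∈ Z.domain, 0 < 1 - ∏ i, x i ^ 2 := fun x hx => by
    rw [hsq x hx]
    have h := hbox x hx
    nlinarith
  have hsa : IsSemialgebraicFunOn ℚ Z.domain (fun x => 1 / (1 - ∏ i, x i ^ 2)) := by
    refine (isSemialgebraicFunOn_aeval_div_aeval Z.isSemialgebraic_domain (1 : MvPolynomial (Fin n) ℚ)
      (1 - ∏ i, MvPolynomial.X i ^ 2) fun x hx => ?_).congr fun x _ => by simp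
    simpa using (hden x hx).ne'
  have hle : ∀ x ∈ Z.domain, 1 / (1 - ∏ i, x i ^ 2) ≤ Z.integrand x := fun x hx => by
    rw [hZi hx, hsq x hx]
    have h := hbox x hx
    have h1 : 0 < 1 - ∏ i, x i := by linarith
    apply one_div_le_one_div_of_le h1
    nlinarith
  have hint : IntegrableOn (fun x => 1 / (1 - ∏ i, x i ^ 2)) Z.domain := by
    refine Integrable.mono' Z.integrableOn
      (KZ.aestronglyMeasurable_of_isSemialgebraicFunOn hsa (KZ.IntegralRep.measurableSet_domain_holds Z)) ?_
    filter_upwards [ae_restrict_mem (KZ.IntegralRep.measurableSet_domain_holds Z)] with x hx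
    rw [Real.norm_eq_abs, abs_of_pos (one_div_pos.mpr (hden x hx))]
    exact hle x hx
  exact ⟨⟨Z.domain, _, Z.isSemialgebraic_domain, hsa, hint⟩, hZd, fun x _ => rfl⟩

/-- **Euler's `ζ(2k) ∈ ℚ·π^{2k}` inside the calculus puts `[(0,1)^{2k}, 1/(1−∏xᵢ²)]` in Lindemann's ring**:
`[(0,1)^{2k}, 1/(1−∏xᵢ²)] ~ [(0,1)^{2k}, q·∏ 1/(1+xᵢ²)]` for some `q ∈ ℚ` (the landed crux `ZetaEvenBKC`:
Beukers–Kolk–Calabi's rational substitution and Elkies' dissection), and the right-hand side is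
`⟦[pt, q]⟧·⟦A⟧^{2k}`. [cite: BeukersCalabiKolk1993] [cite: KontsevichZagier2001, §1.2] -/
theorem lindemann_mem_zetaBoxSqAll (k : ℕ) (hk : 1 ≤ k) (Z' : KZ.IntegralRep (2 * k))
    (hZ'd : Z'.domain = {x | ∀ i, x i ∈ Set.Ioo (0:ℝ) 1})
    (hZ'i : Set.EqOn Z'.integrand (fun x => 1 / (1 - ∏ i, x i ^ 2)) Z'.domain) :
    KZ.toFormalPeriod (KZ.of Z') ∈ Subring.closure
      ({p : KZ.FormalPeriodRing | ∃ (a : ℝ) (ha : IsAlgebraic ℚ a),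
          p = KZ.toFormalPeriod (KZ.of (KZ.IntegralRep.unit.constMul a ha))} ∪
        {p : KZ.FormalPeriodRing | ∃ A : KZ.IntegralRep 1, A.domain = {t | t 0 ∈ Set.Ioo (0:ℝ) 1} ∧
          Set.EqOn A.integrand (fun t => 1 / (1 + t 0 ^ 2)) A.domain ∧ p = KZ.toFormalPeriod (KZ.of A)}) := by
  obtain ⟨q, hq⟩ :=
    Summit.KontsevichZagierPeriods.Theorems.CompiledSubstitutionsZetaEvenBKC.zetaEvenBKC_proof k hk
  obtain ⟨B, hBd, hBi⟩ := arctanBox_exists (2 * k)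
  have hqalg : IsAlgebraic ℚ (q : ℝ) := isAlgebraic_algebraMap q
  have hequiv : KZ.Equivalent Z' (B.constMul (q : ℝ) hqalg) :=
    hq Z' (B.constMul (q : ℝ) hqalg) hZ'd hZ'i (by rw [KZ.IntegralRep.domain_constMul, hBd])
      fun x hx => by
        rw [KZ.IntegralRep.integrand_constMul]
        simp only
        rw [hBi hx]
  rw [hequiv.toFormalPeriod_eq, KZ.toFormalPeriod_of_constMul]
  exact Subring.mul_mem _ (lindemann_mem_pt hqalg) (lindemann_mem_arctanBox (2 * k) B hBd hBi)

/-- **EVERY EVEN ZETA BOX LIES IN LINDEMANN'S RING**: `(4^k − 1)·⟦[(0,1)^{2k}, 1/(1−∏xᵢ)]⟧ =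
4^k·⟦[(0,1)^{2k}, 1/(1−∏xᵢ²)]⟧` (the odd/even splitting `stub_zetaBoxOddEvenAll`), the right-hand side
is in the ring (`lindemann_mem_zetaBoxSqAll`), and the ring is closed under division by `4^k − 1 > 0`.
The value is `ζ(2k)`. [cite: KontsevichZagier2001, §1.2] -/
theorem lindemann_mem_zetaBoxAll :
    ∀ (k : ℕ), 1 ≤ k → ∀ (Z : KZ.IntegralRep (2 * k)), Z.domain = {x | ∀ i, x i ∈ Set.Ioo (0:ℝ) 1} →
      Set.EqOn Z.integrand (fun x => 1 / (1 - ∏ i, x i)) Z.domain →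
      KZ.toFormalPeriod (KZ.of Z) ∈ Subring.closure
        ({p : KZ.FormalPeriodRing | ∃ (a : ℝ) (ha : IsAlgebraic ℚ a),
            p = KZ.toFormalPeriod (KZ.of (KZ.IntegralRep.unit.constMul a ha))} ∪
          {p : KZ.FormalPeriodRing | ∃ A : KZ.IntegralRep 1, A.domain = {t | t 0 ∈ Set.Ioo (0:ℝ) 1} ∧
            Set.EqOn A.integrand (fun t => 1 / (1 + t 0 ^ 2)) A.domain ∧ p = KZ.toFormalPeriod (KZ.of A)}) := by
  intro k hk Z hZd hZi
  obtain ⟨Z', hZ'd, hZ'i⟩ := lindemann_exists_zetaBoxSq (by omega) Z hZd hZi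
  have hrel := stub_zetaBoxOddEvenAll k hk Z Z' hZd hZi hZ'd hZ'i
  have hP : ((4 ^ k - 1 : ℕ) : KZ.FormalPeriodRing) * KZ.toFormalPeriod (KZ.of Z) =
      (4 : KZ.FormalPeriodRing) ^ k * KZ.toFormalPeriod (KZ.of Z') := by
    have h := KZ.toFormalPeriod_eq_iff.mpr hrel
    rw [map_nsmul, map_nsmul, nsmul_eq_mul, nsmul_eq_mul] at h
    exact_mod_cast h
  have hpos : 0 < 4 ^ k - 1 := by
    have : 4 ≤ 4 ^ k := by
      calc (4 : ℕ) = 4 ^ 1 := by norm_num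
        _ ≤ 4 ^ k := Nat.pow_le_pow_right (by norm_num) hk
    omega
  refine lindemann_mem_of_natCast_mul hpos ?_
  rw [hP]
  exact Subring.mul_mem _ (Subring.pow_mem _ (natCast_mem _ 4) k) (lindemann_mem_zetaBoxSqAll k hk Z' hZ'd hZ'i)

/-! ## Weight two: KZ's box, the `Li₂(1)`-triangle, Kontsevich's word -/

/-- **Kontsevich–Zagier's `ζ(2)` box `[(0,1)², 1/(1−xy)]` lies in Lindemann's ring** (the case `k = 1` of
`lindemann_mem_zetaBoxAll`). [cite: KontsevichZagier2001, §1.2] -/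
theorem lindemann_mem_zetaBox (Z : KZ.IntegralRep 2) (hZd : Z.domain = {x | ∀ i, x i ∈ Set.Ioo (0:ℝ) 1})
    (hZi : Set.EqOn Z.integrand (fun x => 1 / (1 - x 0 * x 1)) Z.domain) :
    KZ.toFormalPeriod (KZ.of Z) ∈ Subring.closure
      ({p : KZ.FormalPeriodRing | ∃ (a : ℝ) (ha : IsAlgebraic ℚ a),
          p = KZ.toFormalPeriod (KZ.of (KZ.IntegralRep.unit.constMul a ha))} ∪
        {p : KZ.FormalPeriodRing | ∃ A : KZ.IntegralRep 1, A.domain = {t | t 0 ∈ Set.Ioo (0:ℝ) 1} ∧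
          Set.EqOn A.integrand (fun t => 1 / (1 + t 0 ^ 2)) A.domain ∧ p = KZ.toFormalPeriod (KZ.of A)}) :=
  lindemann_mem_zetaBoxAll 1 le_rfl Z hZd fun x hx => by
    rw [hZi hx]
    show (1 : ℝ) / (1 - x 0 * x 1) = 1 / (1 - ∏ i : Fin 2, x i)
    rw [Fin.prod_univ_two]

/-- **The `Li₂(1)`-triangle `[{0<v<u<1}, 1/(u(1−v))]` lies in Lindemann's ring**: it is ONE change of
variables away from KZ's box (`stub_zetaBoxTriangle`, `(x,y) ↦ (x, xy)`), for which we use the tree's cube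
representation `MzvKernelInKZ.Negative.C2cube`. [cite: KontsevichZagier2001, §1.2] -/
theorem lindemann_mem_dilogOne (L : KZ.IntegralRep 2) (hLd : L.domain = {w | 0 < w 1 ∧ w 1 < w 0 ∧ w 0 < 1})
    (hLi : Set.EqOn L.integrand (fun w => 1 / (w 0 * (1 - w 1))) L.domain) :
    KZ.toFormalPeriod (KZ.of L) ∈ Subring.closure
      ({p : KZ.FormalPeriodRing | ∃ (a : ℝ) (ha : IsAlgebraic ℚ a),
          p = KZ.toFormalPeriod (KZ.of (KZ.IntegralRep.unit.constMul a ha))} ∪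
        {p : KZ.FormalPeriodRing | ∃ A : KZ.IntegralRep 1, A.domain = {t | t 0 ∈ Set.Ioo (0:ℝ) 1} ∧
          Set.EqOn A.integrand (fun t => 1 / (1 + t 0 ^ 2)) A.domain ∧ p = KZ.toFormalPeriod (KZ.of A)}) := by
  have hZd : Summit.KontsevichZagierPeriods.MzvKernelInKZ.Negative.C2cube.domain =
      {x : Fin 2 → ℝ | ∀ i, x i ∈ Set.Ioo (0:ℝ) 1} := by
    ext x
    change x ∈ Summit.KontsevichZagierPeriods.MzvKernelInKZ.Negative.cube2 ↔ _
    rw [Summit.KontsevichZagierPeriods.MzvKernelInKZ.Negative.mem_cube2]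
    simp only [Set.mem_setOf_eq, Fin.forall_fin_two, Set.mem_Ioo]
  have hZi : Set.EqOn Summit.KontsevichZagierPeriods.MzvKernelInKZ.Negative.C2cube.integrand
      (fun x => 1 / (1 - x 0 * x 1)) Summit.KontsevichZagierPeriods.MzvKernelInKZ.Negative.C2cube.domain :=
    fun x _ => rfl
  have h := stub_zetaBoxTriangle _ L hZd hZi hLd hLi
  rw [← KZ.toFormalPeriod_eq_iff.mpr h]
  exact lindemann_mem_zetaBox _ hZd hZi

/-- **Kontsevich's word representation `[Δ₂, ω₀ω₁]` of `ζ(2)` lies in Lindemann's ring** (it IS the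
`Li₂(1)`-triangle: same set `{1 > t₀ > t₁ > 0}`, same integrand `t₀⁻¹(1−t₁)⁻¹`). [cite: KontsevichZagier2001, §1.1] -/
theorem lindemann_mem_zetaTwoWord :
    KZ.toFormalPeriod (KZ.of (Summit.KontsevichZagierPeriods.MzvKernelInKZ.Negative.wordRep
      Summit.KontsevichZagierPeriods.MzvKernelInKZ.Negative.ω2 1
      Summit.KontsevichZagierPeriods.MzvKernelInKZ.Negative.adm_ω2)) ∈ Subring.closure
      ({p : KZ.FormalPeriodRing | ∃ (a : ℝ) (ha : IsAlgebraic ℚ a),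
          p = KZ.toFormalPeriod (KZ.of (KZ.IntegralRep.unit.constMul a ha))} ∪
        {p : KZ.FormalPeriodRing | ∃ A : KZ.IntegralRep 1, A.domain = {t | t 0 ∈ Set.Ioo (0:ℝ) 1} ∧
          Set.EqOn A.integrand (fun t => 1 / (1 + t 0 ^ 2)) A.domain ∧ p = KZ.toFormalPeriod (KZ.of A)}) := by
  refine lindemann_mem_dilogOne _ ?_ fun t _ => ?_
  · ext t
    rw [Summit.KontsevichZagierPeriods.MzvKernelInKZ.Negative.wordRep_domain,
      Summit.KontsevichZagierPeriods.MzvKernelInKZ.Negative.mem_simplex_two'']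
    simp only [Set.mem_setOf_eq]
    constructor
    · rintro ⟨_, h1, h2, _, h4⟩
      exact ⟨h1, h4, h2⟩
    · rintro ⟨h1, h2, h3⟩
      exact ⟨by linarith, h1, h3, by linarith, h2⟩
  · rw [Summit.KontsevichZagierPeriods.MzvKernelInKZ.Negative.wordRep_integrand]
    simp [Summit.KontsevichZagierPeriods.MzvKernelInKZ.Negative.wordFun,
      Summit.KontsevichZagierPeriods.MzvKernelInKZ.Negative.ω2, Fin.prod_univ_two, mul_comm]

/-! ## Consequences: equal values ⇒ equal classes across the ring -/

/-- **EQUAL VOLUME ⇒ KZ-EQUIVALENT ACROSS LINDEMANN'S RING**: two representations whose classes lie in `R_π`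
and whose values agree are move-equivalent (`stub_lindemannRing` on the difference). This is Conjecture 1 for
points, arctangent carriers, discs, ellipses, even balls, even zeta boxes, `Li₂(1)` and all their products,
jointly. [cite: KontsevichZagier2001, §1.2] -/
theorem lindemann_equivalent_of_value_eq {n m : ℕ} (r : KZ.IntegralRep n) (s : KZ.IntegralRep m)
    (hr : KZ.toFormalPeriod (KZ.of r) ∈ Subring.closure
      ({p : KZ.FormalPeriodRing | ∃ (a : ℝ) (ha : IsAlgebraic ℚ a),
          p = KZ.toFormalPeriod (KZ.of (KZ.IntegralRep.unit.constMul a ha))} ∪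
        {p : KZ.FormalPeriodRing | ∃ A : KZ.IntegralRep 1, A.domain = {t | t 0 ∈ Set.Ioo (0:ℝ) 1} ∧
          Set.EqOn A.integrand (fun t => 1 / (1 + t 0 ^ 2)) A.domain ∧ p = KZ.toFormalPeriod (KZ.of A)}))
    (hs : KZ.toFormalPeriod (KZ.of s) ∈ Subring.closure
      ({p : KZ.FormalPeriodRing | ∃ (a : ℝ) (ha : IsAlgebraic ℚ a),
          p = KZ.toFormalPeriod (KZ.of (KZ.IntegralRep.unit.constMul a ha))} ∪
        {p : KZ.FormalPeriodRing | ∃ A : KZ.IntegralRep 1, A.domain = {t | t 0 ∈ Set.Ioo (0:ℝ) 1} ∧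
          Set.EqOn A.integrand (fun t => 1 / (1 + t 0 ^ 2)) A.domain ∧ p = KZ.toFormalPeriod (KZ.of A)}))
    (h : r.value = s.value) : KZ.Equivalent r s :=
  KZ.toFormalPeriod_eq_iff.mp (lindemannRing_eq_of_evalP_eq hr hs
    (by rw [KZ.evalP_toFormalPeriod_of, KZ.evalP_toFormalPeriod_of, h]))

/-- **BASEL INSIDE THE CALCULUS**: `6·[Li₂(1)-triangle] − [D × D] ∈ relations` for the open unit disc `D`
(integrand `1`): both classes lie in Lindemann's ring and both evaluate to `π²` (`Li₂(1) = ζ(2) = π²/6`,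
tree `MzvKernelInKZ.Negative.value_ω2`; `vol (D × D) = π·π`, Fubini). Kontsevich–Zagier's own §1.2 example of
an accessible identity; the transcendence-free move chain `3·[Δ₂, ω₀₁] ≡ 2·[Q²]` (Beukers–Kolk–Calabi) is
the tree's `MzvKernelInKZ.Negative.three_zeta_two_sub_two_G2_mem`. [cite: KontsevichZagier2001, §1.2] -/
theorem basel_mem_relations (L D : KZ.IntegralRep 2) (hLd : L.domain = {w | 0 < w 1 ∧ w 1 < w 0 ∧ w 0 < 1})
    (hLi : Set.EqOn L.integrand (fun w => 1 / (w 0 * (1 - w 1))) L.domain)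
    (hD : D.domain = {p | p 0 ^ 2 + p 1 ^ 2 < 1}) (hDi : ∀ p ∈ D.domain, D.integrand p = 1) :
    6 • KZ.of L - KZ.of (D.prod D) ∈ KZ.relations := by
  -- the value of `L`: it is move-equivalent to Kontsevich's word, of value `π²/6`
  have hLw : KZ.of L - KZ.of (Summit.KontsevichZagierPeriods.MzvKernelInKZ.Negative.wordRep
      Summit.KontsevichZagierPeriods.MzvKernelInKZ.Negative.ω2 1
      Summit.KontsevichZagierPeriods.MzvKernelInKZ.Negative.adm_ω2) ∈ KZ.relations := by
    refine KZ.of_sub_of_mem_relations_of_eqOn ?_ fun t ht => ?_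
    · ext t
      rw [Summit.KontsevichZagierPeriods.MzvKernelInKZ.Negative.wordRep_domain,
        Summit.KontsevichZagierPeriods.MzvKernelInKZ.Negative.mem_simplex_two'', hLd]
      simp only [Set.mem_setOf_eq]
      constructor
      · rintro ⟨_, h1, h2, _, h4⟩
        exact ⟨h1, h4, h2⟩
      · rintro ⟨h1, h2, h3⟩
        exact ⟨by linarith, h1, h3, by linarith, h2⟩
    · rw [hLi ht, Summit.KontsevichZagierPeriods.MzvKernelInKZ.Negative.wordRep_integrand]
      simp [Summit.KontsevichZagierPeriods.MzvKernelInKZ.Negative.wordFun,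
        Summit.KontsevichZagierPeriods.MzvKernelInKZ.Negative.ω2, Fin.prod_univ_two, mul_comm]
  have hLv : L.value = Real.pi ^ 2 / 6 := by
    have h0 : KZ.eval (KZ.of L - KZ.of (Summit.KontsevichZagierPeriods.MzvKernelInKZ.Negative.wordRep
        Summit.KontsevichZagierPeriods.MzvKernelInKZ.Negative.ω2 1
        Summit.KontsevichZagierPeriods.MzvKernelInKZ.Negative.adm_ω2)) = 0 :=
      KZ.relations_le_ker_eval_holds hLw
    rw [map_sub, KZ.eval_of, KZ.eval_of, Summit.KontsevichZagierPeriods.MzvKernelInKZ.Negative.value_ω2,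
      sub_eq_zero] at h0
    exact h0
  -- both sides in the ring, both of value `π²`
  have h6 : IsAlgebraic ℚ ((6 : ℕ) : ℝ) := isAlgebraic_nat 6
  have hL6 : KZ.of (L.constMul ((6 : ℕ) : ℝ) h6) - 6 • KZ.of L ∈ KZ.relations :=
    L.of_constMul_nat_sub_nsmul_mem_relations 6
  have hmemL := Subring.mul_mem _ (lindemann_mem_pt h6) (lindemann_mem_dilogOne L hLd hLi)
  rw [← KZ.toFormalPeriod_of_constMul] at hmemL
  have hmemD := lindemann_mem_prod (lindemann_mem_disc isAlgebraic_one D hD hDi)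
    (lindemann_mem_disc isAlgebraic_one D hD hDi)
  have hval : (L.constMul ((6 : ℕ) : ℝ) h6).value = (D.prod D).value := by
    rw [KZ.IntegralRep.value_constMul, hLv, KZ.IntegralRep.value_prod, value_openDisc D hD hDi]
    push_cast
    ring
  have hequiv := lindemann_equivalent_of_value_eq _ _ hmemL hmemD hval
  have e : 6 • KZ.of L - KZ.of (D.prod D) =
      (KZ.of (L.constMul ((6 : ℕ) : ℝ) h6) - KZ.of (D.prod D)) -
        (KZ.of (L.constMul ((6 : ℕ) : ℝ) h6) - 6 • KZ.of L) := by abel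
  rw [e]
  exact sub_mem hequiv hL6

/-- **`2·[B₄] − [D × D] ∈ relations`** (`vol B₄ = π²/2 = vol(D)²/2`), TRANSCENDENCE-FREE: in the formal period
ring `2·⟦B₄⟧ = ⟦β(½,½)⟧²` (`KZ.BallPeeling.factorial_mul_toFormalPeriod_ball`, `k = 2`),
`⟦β(½,½)⟧ = ⟦[disc, 1]⟧` (`…natCast_add_one_mul_toFormalPeriod_disc`, `e = 0`) and `⟦D × D⟧ = ⟦D⟧²`.
[cite: KontsevichZagier2001, §1.1] -/
theorem ballFour_two_discs_mem_relations (b : KZ.IntegralRep (2 * 2)) (D : KZ.IntegralRep 2)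
    (hbd : b.domain = {z | ∑ i, (z i) ^ 2 < 1}) (hbi : Set.EqOn b.integrand (fun _ => 1) b.domain)
    (hD : D.domain = {p | p 0 ^ 2 + p 1 ^ 2 < 1}) (hDi : ∀ p ∈ D.domain, D.integrand p = 1) :
    2 • KZ.of b - KZ.of (D.prod D) ∈ KZ.relations := by
  obtain ⟨H, hHd, hHi⟩ := KZ.exists_betaRep' (1 / 2) (1 / 2) (by norm_num) (by norm_num)
  have hdir := Summit.KontsevichZagierPeriods.GammaHodgeSectorKO.dir_pinned_of_betaClass
    Summit.KontsevichZagierPeriods.TerasomaMultiplication.GammaHodgeFromRelators.betaClass_reassoc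
  have hball := KZ.BallPeeling.factorial_mul_toFormalPeriod_ball 2 b H hbd hbi hHd (fun t _ => by rw [hHi]) hdir
  have hD' : D.domain = {w : Fin 2 → ℝ | ∑ i, (w i) ^ 2 < 1} := by
    rw [hD]
    ext w
    simp [Fin.sum_univ_two]
  have hdisc := KZ.BallPeeling.natCast_add_one_mul_toFormalPeriod_disc 0 D H hD'
    (fun w hw => by rw [hDi w hw]; simp) hHd (fun t _ => by rw [hHi]) hdir
  rw [Nat.cast_zero, zero_add, one_mul] at hdisc
  have h2 : ((Nat.factorial 2 : ℕ) : KZ.FormalPeriodRing) = 2 := by norm_num [Nat.factorial]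
  have hP : KZ.toFormalPeriod (2 • KZ.of b) = KZ.toFormalPeriod (KZ.of (D.prod D)) := by
    rw [map_nsmul, nsmul_eq_mul, ← KZ.toFormalPeriod_of_mul_of, hdisc,
      ← pow_two (KZ.toFormalPeriod (KZ.of H)), ← hball, h2]
    norm_num
  exact KZ.toFormalPeriod_eq_iff.mp hP

end Summit.KontsevichZagierPeriods.HyperbolicBloch.OffTetraSectorKernel

end
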